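import Literature.NumberTheory.PAdicHodge.KummerFilZeroCoboundaryRamified
import Literature.NumberTheory.PAdicHodge.BdRPeriodDeterminantOfWeil
import Literature.NumberTheory.PAdicHodge.DeRhamSupersingularRamifiedCells
import HarnessLib

/-!
# The Kummer cocycle of a rational formal point dies in `H¹(F, B_dR⁺ ⊗ V_pE)` over the RAMIFIED base `𝒪_D`, with the Hodge–Tate
# witness DISCHARGED by the Weil determinant — and unconditionally on the explicit supersingular cell models

Topic `Literature/NumberTheory/PAdicHodge`; namespace `Literature.NumberTheory.PAdicHodge`. THEOREMS ONLY (no definition, no named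
fact, no instance, no `sorry`). Sequel of `KummerFilZeroCoboundaryRamified` (brick K1 of the hT₂ programme of crux K★
`stmt-BirchSwinnertonDyer-22226` over `𝒪_D = ℤ_p[ϖ]`, modulo (HT) `∃ τ, ∫_τ ω ∉ (Fil¹)²` and (Nη) `∃ τ, ∫_τ η ∉ Fil¹`) and of
`BdRPeriodDeterminantOfWeil` (Tate's Hodge–Tate nonvanishing from `det ρ_{E,p} = χ`, `B_dR^{Γ_F} = F`, `σt = χ(σ)t`):

* §1 `algebraMap_mem_fil_two_of_mem_sq` — the bridge `(Fil¹ B_dR⁺)² ↦ Fil² B_dR` (converse of `mem_sq_of_algebraMap_mem_fil_two`).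
* §2 **`AinfRamTop.exists_omegaPeriodHomO_not_mem_filOne_sq_of_matching`** — (HT) over the ramified base: for `W` over `CoeffDisc D`,
  `ψ : 𝒪_D → 𝒪_F`, an elliptic `W₀/K₀` (`K₀ ⊆ F`) with an equivariant `ℤ_p`-matching `e : T_pW₀ ≃ T_pŴ♭(𝒪_{ℂ_F})`, (N1′) `∫_τ ω ≠ 0` for
  some `τ` and (Nη) `∫_τ η ∉ Fil¹` for some `τ` ⟹ **`∫_τ ω ∉ (Fil¹ B_dR⁺)²` for some `τ`** — Tate's theorem «the Hodge–Tate map of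
  `T_pŴ` is nonzero», now over every ramified base (the tree's tilt proof `AinfWeierstrassHodgeTateNonvanishing` needs `𝒪 = ℤ_p`, `p ≥ 5`).
* §3 **`isFilZeroCoboundary_kummerCocycleO_restricted_of_matching_of_ne_zero`** (+ `_of_coeffDisc_of_ne_zero`) — the K1 capstone of
  `KummerFilZeroCoboundaryRamified` with (HT) REPLACED by (N1′) and (Nη) read as `∫_τ η ∉ Fil¹`.
* §4 **`isFilZeroCoboundary_kummerCocycleO_restricted_of_matching_explicitModel`** — for the explicit good supersingular `𝒪_D`-models
  `W_D = ⟨0, 0, 0, a ϱ^{r₄}, b ϱ^{r₆}⟩` over `𝒪_D = ℤ_p[X]/(X^e − p)` (`p ∈ {5, 7}`, `3r₄ = e t₄`, `2r₆ = e t₆`, `64a³p^{t₄} + 432b²p^{t₆} ∈ ℤ_pˣ`,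
  (N1′) inequalities `0 < r₄, e < 9, e < r₄ + 4` at `5` / `0 < r₆, e < 13, e < r₆ + 6` at `7` — the three K★ cells `(5; IV*), (5; II*),
  (7; III*)` and TDS57's `(5; IV)`): (N1′) is `omegaPeriod_model_{five,seven}_ne_zero_of_lt`, (Nη) is `exists_etaPeriodHomO_not_mem_filOne`,
  (HT) is §2 — so for EVERY equivariant matching `e` and EVERY `[p]_W`-division sequence with a `Γ_F`-fixed lift of its base, the Kummer
  cocycle `σ ↦ 1 ⊗ e⁻¹(κ_u σ)` is a `Fil⁰`-coboundary of `B_dR(F) ⊗ V_pW₀|_{Γ_F}`, with NO period hypothesis left.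

BSD / K★ are not proved by any of this (K★ ⟸ {P1-bar, hT₂}); this is the «⟸» mechanism of (S5a) for Kummer classes of formal points.

## References
* [BlochKato1990] S. Bloch, K. Kato (1990), Ex. 3.10.1, (3.11.1), Lemma 3.8.1.
* [Tate1967] J. Tate, *p-divisible groups* (1967), §3.3 Thm. 2, §4 Cor. 2.
* [Fontaine1982FormesDifferentielles] J.-M. Fontaine, Invent. Math. 65 (1982), §5.
* [Colmez1992PeriodesAbeliennes] P. Colmez, Math. Ann. 292 (1992), §2.
* [Kato1993LNM1553] K. Kato, LNM 1553 (1993), Ch. II Lemma 1.4.3.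
-/

noncomputable section

open scoped TensorProduct

namespace Literature.NumberTheory.PAdicHodge

open Literature Literature.NumberTheory.GaloisRepresentations Literature.NumberTheory.EllipticCurves WeierstrassCurve
open Literature.NumberTheory.GaloisRepresentations.IsNonarchimedeanLocalField Field ValuativeRel
open Literature.NumberTheory.GaloisRepresentations.LubinTate Polynomial

variable {F : Type} [Field F] [ValuativeRel F] [TopologicalSpace F] [IsNonarchimedeanLocalField F] [CharZero F]
  {p : ℕ} [Fact p.Prime] [Fact (¬ IsUnit (p : integerC F))] [IsAdicComplete (Ideal.span {(p : integerC F)}) (integerC F)]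
  (hp : valuation F p < 1) [Algebra ℚ_[p] F]

/-! ## §1 The bridge `(Fil¹ B_dR⁺)² → Fil² B_dR` -/

/-- **Bridge, `(Fil¹)² ⊆ Fil²`**: if `y ∈ (ξ)²` in `B_dR⁺`, then its image in `B_dR` lies in `Fil² = ξ²B_dR⁺` (converse of
`mem_sq_of_algebraMap_mem_fil_two`). [cite: FontaineAsterisque223III, Exp. II §1.5.5] -/
theorem algebraMap_mem_fil_two_of_mem_sq (y : BdRPlusTop F p)
    (h : y ∈ ((BdRPlusTop.filOne F p).toIdeal ^ 2 : Ideal (BdRPlusTop F p))) :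
    algebraMap (BDeRhamPlus (integerC F) p) (FracBdR F p) ((BdRPlusTop.of F p).symm y) ∈
      (bdRPeriodRingData (F := F) (p := p) hp).fil 2 := by
  have hF := surjective_fontaineTheta_integerC hp
  haveI : IsDomain (BDeRhamPlus (integerC F) p) := isDomain_bDeRhamPlus hF
  letI : Algebra F (FracBdR F p) := fracAlgebra hp hF
  rw [show (BdRPlusTop.filOne F p).toIdeal = (WithIdeal.i : Ideal (BdRPlusTop F p)) from rfl, BdRPlusTop.ideal_eq,
    Ideal.span_singleton_pow, Ideal.mem_span_singleton'] at h
  obtain ⟨z, hz⟩ := h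
  change _ ∈ fil hp hF 2
  rw [mem_fil_iff]
  refine ⟨(BdRPlusTop.of F p).symm z, ?_⟩
  rw [← hz, map_mul, map_pow, RingEquiv.symm_apply_apply, map_mul, map_pow,
    show (2 : ℤ) = ((2 : ℕ) : ℤ) from rfl, zpow_natCast, mul_comm]

/-! ## §2 (HT) over the ramified base: the Hodge–Tate map of `T_pŴ♭` is nonzero -/

/-- **Tate's Hodge–Tate nonvanishing over the ramified base `𝒪_D`.** `W` over `CoeffDisc D`, `ψ : 𝒪_D → 𝒪_F` the coefficient map,
`W₀` elliptic over `K₀ ⊆ F` with an equivariant `ℤ_p`-matching `e : T_pW₀ ≃ T_pŴ♭(𝒪_{ℂ_F})` (`W♭ = W ⊗_ψ 𝒪_F`); if `∫_τ ω ≠ 0` for some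
`τ` (N1′) and `∫_τ η ∉ Fil¹` for some `τ` (Nη), then **`∫_τ ω ∉ (Fil¹ B_dR⁺)²` for some `τ`**: the determinant of the two periods is
`F^× · t` (`exists_not_mem_fil_two_restrictedRationalTateRep_of_periodHoms`, Weil determinant + `B_dR^{Γ_F} = F`).
[cite: Tate1967, §4 Cor. 2] [cite: Fontaine1982FormesDifferentielles, §5] [cite: Colmez1992PeriodesAbeliennes, §2] -/
theorem AinfRamTop.exists_omegaPeriodHomO_not_mem_filOne_sq_of_matching (D : EisensteinRoot F p hp)
    (W : WeierstrassCurve (EisensteinRoot.CoeffDisc D)) (ψ : EisensteinRoot.CoeffDisc D →+* LTCoeff F)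
    (hψ : ∀ c, algebraMap (LTCoeff F) F (ψ c) = EisensteinRoot.CoeffDisc.toF D c)
    {K₀ : Type} [Field K₀] [CharZero K₀] (W₀ : WeierstrassCurve K₀) [W₀.IsElliptic] [Algebra K₀ F]
    (e : W₀.tateModule p ≃ₗ[ℤ_[p]] AinfTop.TatePtO F (W.map ψ) p)
    (he : ∀ (σ : absoluteGaloisGroup F) (a : W₀.tateModule p), e (absGaloisRestrict K₀ F σ • a) = σ • e a)
    (hN1 : ∃ τ : AinfTop.TatePtO F (W.map ψ) p, AinfRamTop.omegaPeriodHomO W ψ (surjective_fontaineTheta_integerC hp) hψ τ ≠ 0)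
    (hNη : ∃ τ : AinfTop.TatePtO F (W.map ψ) p,
      AinfRamTop.etaPeriodHomO W ψ (surjective_fontaineTheta_integerC hp) hψ τ ∉ (BdRPlusTop.filOne F p).toIdeal) :
    ∃ τ : AinfTop.TatePtO F (W.map ψ) p, AinfRamTop.omegaPeriodHomO W ψ (surjective_fontaineTheta_integerC hp) hψ τ ∉
      ((BdRPlusTop.filOne F p).toIdeal ^ 2 : Ideal (BdRPlusTop F p)) := by
  have hF := surjective_fontaineTheta_integerC hp
  have halg : ∀ c : ℚ_[p], algebraMap ℚ_[p] F c = LocalField.padicRingHom F p hp c := fun c =>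
    RingHom.congr_fun (LocalField.ringHom_padic_ext _ _) c
  -- the bridge `B_dR⁺ → B_dR` and the two period functionals on `T_pW₀`
  let ιB : BdRPlusTop F p →+* (bdRPeriodRingData (F := F) (p := p) hp).B :=
    (algebraMap (BDeRhamPlus (integerC F) p) (FracBdR F p)).comp (BdRPlusTop.of F p).symm.toRingHom
  have hιB : ∀ y, ιB y = algebraMap (BDeRhamPlus (integerC F) p) (FracBdR F p) ((BdRPlusTop.of F p).symm y) :=
    fun _ => rfl
  let φ₁ : W₀.tateModule p →+ (bdRPeriodRingData (F := F) (p := p) hp).B :=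
    ιB.toAddMonoidHom.comp ((AinfRamTop.omegaPeriodHomO W ψ hF hψ).comp e.toAddMonoidHom)
  let φ₂ : W₀.tateModule p →+ (bdRPeriodRingData (F := F) (p := p) hp).B :=
    ιB.toAddMonoidHom.comp ((AinfRamTop.etaPeriodHomO W ψ hF hψ).comp e.toAddMonoidHom)
  have hφ₁ : ∀ a, φ₁ a = ιB (AinfRamTop.omegaPeriodHomO W ψ hF hψ (e a)) := fun _ => rfl
  have hφ₂ : ∀ a, φ₂ a = ιB (AinfRamTop.etaPeriodHomO W ψ hF hψ (e a)) := fun _ => rfl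
  have hsc : ∀ (c : ℤ_[p]) (y : BdRPlusTop F p),
      ιB (BdRPlusTop.of F p (qpToBdR (c : ℚ_[p])) * y) = (c : ℚ_[p]) • ιB y := fun c y => by
    rw [map_mul, Algebra.smul_def, PeriodRingData.algebraMap_eq]
    congr 1
    change algebraMap (BDeRhamPlus (integerC F) p) (FracBdR F p) (qpToBdR (c : ℚ_[p])) =
      algebraMap (BDeRhamPlus (integerC F) p) (FracBdR F p) (embBdRHom hp hF (algebraMap ℚ_[p] F c))
    rw [embBdRHom_algebraMap_padic hp hF halg]
  have hgal : ∀ (σ : absoluteGaloisGroup F) (y : BdRPlusTop F p), ιB (BdRPlusTop.gal F p σ y) = σ • ιB y := fun σ y => by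
    change _ = σ • algebraMap (BDeRhamPlus (integerC F) p) (FracBdR F p) ((BdRPlusTop.of F p).symm y)
    rw [smul_algebraMap_fracBdR]
    rfl
  have h₁ : ∀ (c : ℤ_[p]) (a : W₀.tateModule p), φ₁ (c • a) = (c : ℚ_[p]) • φ₁ a := fun c a => by
    rw [hφ₁, hφ₁, LinearEquiv.map_smul, AinfRamTop.omegaPeriodHomO_smul', hsc]
  have h₂ : ∀ (c : ℤ_[p]) (a : W₀.tateModule p), φ₂ (c • a) = (c : ℚ_[p]) • φ₂ a := fun c a => by
    rw [hφ₂, hφ₂, LinearEquiv.map_smul, AinfRamTop.etaPeriodHomO_smul', hsc]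
  have h₃ : ∀ (σ : absoluteGaloisGroup F) (a : W₀.tateModule p), φ₁ (absGaloisRestrict K₀ F σ • a) = σ • φ₁ a := fun σ a => by
    rw [hφ₁, hφ₁, he, ← AinfRamTop.gal_omegaPeriodHomO, hgal]
  have h₄ : ∀ (σ : absoluteGaloisGroup F) (a : W₀.tateModule p), φ₂ (absGaloisRestrict K₀ F σ • a) = σ • φ₂ a := fun σ a => by
    rw [hφ₂, hφ₂, he, ← AinfRamTop.gal_etaPeriodHomO, hgal]
  have h₅ : ∀ a, φ₁ a ∈ (bdRPeriodRingData (F := F) (p := p) hp).fil 1 := fun a => by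
    rw [hφ₁, hιB]
    exact (algebraMap_mem_fil_one_iff hp _).2 (AinfRamTop.omegaPeriodHomO_mem_filOne W ψ _)
  have h₆ : ∀ a, φ₂ a ∈ (bdRPeriodRingData (F := F) (p := p) hp).fil 0 := fun a => by
    rw [hφ₂, hιB]
    haveI : IsDomain (BDeRhamPlus (integerC F) p) := isDomain_bDeRhamPlus hF
    letI : Algebra F (FracBdR F p) := fracAlgebra hp hF
    exact algebraMap_mem_fil_zero hp hF _
  have h₇ : ∃ a, φ₁ a ≠ 0 := by
    obtain ⟨τ, hτ⟩ := hN1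
    refine ⟨e.symm τ, fun h0 => hτ ?_⟩
    rw [hφ₁, LinearEquiv.apply_symm_apply, hιB] at h0
    have h1 := algebraMap_fracBdR_injective (F := F) (p := p) (h0.trans (map_zero _).symm)
    exact (BdRPlusTop.of F p).symm.injective (h1.trans (map_zero _).symm)
  have h₈ : ∃ a, φ₂ a ∉ (bdRPeriodRingData (F := F) (p := p) hp).fil 1 := by
    obtain ⟨τ, hτ⟩ := hNη
    refine ⟨e.symm τ, fun h => hτ ((algebraMap_mem_fil_one_iff hp _).1 ?_)⟩
    rwa [hφ₂, LinearEquiv.apply_symm_apply, hιB] at h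
  obtain ⟨a, ha⟩ := exists_not_mem_fil_two_restrictedRationalTateRep_of_periodHoms hp W₀ φ₁ φ₂ h₁ h₂ h₃ h₄ h₅ h₆ h₇ h₈
  refine ⟨e a, fun h => ha ?_⟩
  rw [hφ₁, hιB]
  exact algebraMap_mem_fil_two_of_mem_sq hp _ h

/-! ## §3 K1 over the ramified base with (HT) discharged -/

/-- **K1 over the ramified base, in the (S5a) currency, with the Hodge–Tate witness DISCHARGED.** As
`isFilZeroCoboundary_kummerCocycleO_restricted_of_matching`, but with (HT) `∃ τ, ∫_τ ω ∉ (Fil¹)²` replaced by (N1′) `∃ τ, ∫_τ ω ≠ 0`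
and (Nη) read as `∃ τ, ∫_τ η ∉ Fil¹`: for `W₀` elliptic over `K₀ ⊆ F` with an equivariant matching `e : T_pW₀ ≃ T_pŴ♭(𝒪_{ℂ_F})` and a
`[p]_W`-division sequence `u` with a `Γ_F`-fixed lift `Q ∈ Ŵ(𝔫_𝒪)` of `u₀`, the Kummer cocycle `σ ↦ 1 ⊗ e⁻¹(κ_u σ)` is a
`Fil⁰`-coboundary of `B_dR(F) ⊗ V_pW₀|_{Γ_F}`. [cite: BlochKato1990, Ex. 3.10.1, (3.11.1), Lemma 3.8.1]
[cite: Kato1993LNM1553, Ch. II Lemma 1.4.3] [cite: Tate1967, §4 Cor. 2] -/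
theorem isFilZeroCoboundary_kummerCocycleO_restricted_of_matching_of_ne_zero (D : EisensteinRoot F p hp)
    (W : WeierstrassCurve (EisensteinRoot.CoeffDisc D)) (ψ : EisensteinRoot.CoeffDisc D →+* LTCoeff F)
    (hψ : ∀ c, algebraMap (LTCoeff F) F (ψ c) = EisensteinRoot.CoeffDisc.toF D c)
    {K₀ : Type} [Field K₀] [CharZero K₀] (W₀ : WeierstrassCurve K₀) [W₀.IsElliptic] [Algebra K₀ F]
    (e : W₀.tateModule p ≃ₗ[ℤ_[p]] AinfTop.TatePtO F (W.map ψ) p)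
    (he : ∀ (σ : absoluteGaloisGroup F) (a : W₀.tateModule p), e (absGaloisRestrict K₀ F σ • a) = σ • e a)
    (hN1 : ∃ τ : AinfTop.TatePtO F (W.map ψ) p, AinfRamTop.omegaPeriodHomO W ψ (surjective_fontaineTheta_integerC hp) hψ τ ≠ 0)
    (hNη : ∃ τ : AinfTop.TatePtO F (W.map ψ) p,
      AinfRamTop.etaPeriodHomO W ψ (surjective_fontaineTheta_integerC hp) hψ τ ∉ (BdRPlusTop.filOne F p).toIdeal)
    {u : ℕ → (maxNilIdealC F).toIdeal} (hup : ∀ n, AinfRamTop.mulPC W (u (n + 1)) = u n)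
    {Q : W.Pt (AinfRamTop.nilTheta D (surjective_fontaineTheta_integerC hp))}
    (hQ : AinfRamTop.thetaPt W (surjective_fontaineTheta_integerC hp) Q = ⟨u 0⟩)
    (hQσ : ∀ σ : absoluteGaloisGroup F, AinfRamTop.galPtN W (surjective_fontaineTheta_integerC hp) σ Q = Q) :
    (bdRPeriodRingData (F := F) (p := p) hp).IsFilZeroCoboundary (restrictedRationalTateRep W₀ F p) fun σ =>
      ((1 : (bdRPeriodRingData (F := F) (p := p) hp).B) ⊗ₜ[ℚ_[p]]
        TateModule.toRational p (e.symm (AinfRamTop.kummerCocycleO W ψ hψ u hup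
          (AinfRamTop.galCBall_base_eq_of_fixedLift W hQ hQσ) σ)) :
        (bdRPeriodRingData (F := F) (p := p) hp).B ⊗[ℚ_[p]] W₀.rationalTateModule p) := by
  have hF := surjective_fontaineTheta_integerC hp
  have halg : ∀ c : ℚ_[p], algebraMap ℚ_[p] F c = LocalField.padicRingHom F p hp c := fun c =>
    RingHom.congr_fun (LocalField.ringHom_padic_ext _ _) c
  -- the bridge `B_dR⁺ → B_dR` and the two period functionals on `T_pW₀`
  let ιB : BdRPlusTop F p →+* (bdRPeriodRingData (F := F) (p := p) hp).B :=
    (algebraMap (BDeRhamPlus (integerC F) p) (FracBdR F p)).comp (BdRPlusTop.of F p).symm.toRingHom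
  have hιB : ∀ y, ιB y = algebraMap (BDeRhamPlus (integerC F) p) (FracBdR F p) ((BdRPlusTop.of F p).symm y) :=
    fun _ => rfl
  let φ₁ : W₀.tateModule p →+ (bdRPeriodRingData (F := F) (p := p) hp).B :=
    ιB.toAddMonoidHom.comp ((AinfRamTop.omegaPeriodHomO W ψ hF hψ).comp e.toAddMonoidHom)
  let φ₂ : W₀.tateModule p →+ (bdRPeriodRingData (F := F) (p := p) hp).B :=
    ιB.toAddMonoidHom.comp ((AinfRamTop.etaPeriodHomO W ψ hF hψ).comp e.toAddMonoidHom)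
  have hφ₁ : ∀ a, φ₁ a = ιB (AinfRamTop.omegaPeriodHomO W ψ hF hψ (e a)) := fun _ => rfl
  have hφ₂ : ∀ a, φ₂ a = ιB (AinfRamTop.etaPeriodHomO W ψ hF hψ (e a)) := fun _ => rfl
  have hsc : ∀ (c : ℤ_[p]) (y : BdRPlusTop F p),
      ιB (BdRPlusTop.of F p (qpToBdR (c : ℚ_[p])) * y) = (c : ℚ_[p]) • ιB y := fun c y => by
    rw [map_mul, Algebra.smul_def, PeriodRingData.algebraMap_eq]
    congr 1
    change algebraMap (BDeRhamPlus (integerC F) p) (FracBdR F p) (qpToBdR (c : ℚ_[p])) =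
      algebraMap (BDeRhamPlus (integerC F) p) (FracBdR F p) (embBdRHom hp hF (algebraMap ℚ_[p] F c))
    rw [embBdRHom_algebraMap_padic hp hF halg]
  have hgal : ∀ (σ : absoluteGaloisGroup F) (y : BdRPlusTop F p), ιB (BdRPlusTop.gal F p σ y) = σ • ιB y := fun σ y => by
    change _ = σ • algebraMap (BDeRhamPlus (integerC F) p) (FracBdR F p) ((BdRPlusTop.of F p).symm y)
    rw [smul_algebraMap_fracBdR]
    rfl
  -- the integrating pair
  have hu₀ := AinfRamTop.galCBall_base_eq_of_fixedLift W hQ hQσ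
  have hω : ∀ σ, BdRPlusTop.gal F p σ (AinfRamTop.bOmega W hup hQ) - AinfRamTop.bOmega W hup hQ =
      AinfRamTop.omegaPeriodHomO W ψ hF hψ (AinfRamTop.kummerCocycleO W ψ hψ u hup hu₀ σ) :=
    AinfRamTop.gal_bOmega_sub_bOmega_eq_omegaPeriodHomO W ψ hup hQ hQσ
  have hη : ∀ σ, BdRPlusTop.gal F p σ (AinfRamTop.bEta W hup hQ) - AinfRamTop.bEta W hup hQ =
      AinfRamTop.etaPeriodHomO W ψ hF hψ (AinfRamTop.kummerCocycleO W ψ hψ u hup hu₀ σ) :=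
    AinfRamTop.gal_bEta_sub_bEta_eq_etaPeriodHomO W ψ hup hQ hQσ
  refine isFilZeroCoboundary_restrictedRationalTateRep_of_periodHoms_of_ne_zero hp W₀ φ₁ φ₂ (fun c a => ?_) (fun c a => ?_)
    (fun σ a => ?_) (fun σ a => ?_) (fun a => ?_) (fun a => ?_) ?_ ?_
    (fun σ => e.symm (AinfRamTop.kummerCocycleO W ψ hψ u hup hu₀ σ)) (b₁ := ιB (AinfRamTop.bOmega W hup hQ))
    (b₂ := ιB (AinfRamTop.bEta W hup hQ)) ?_ ?_ (fun σ => ?_) (fun σ => ?_)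
  · rw [hφ₁, hφ₁, LinearEquiv.map_smul, AinfRamTop.omegaPeriodHomO_smul', hsc]
  · rw [hφ₂, hφ₂, LinearEquiv.map_smul, AinfRamTop.etaPeriodHomO_smul', hsc]
  · rw [hφ₁, hφ₁, he, ← AinfRamTop.gal_omegaPeriodHomO, hgal]
  · rw [hφ₂, hφ₂, he, ← AinfRamTop.gal_etaPeriodHomO, hgal]
  · rw [hφ₁, hιB]
    exact (algebraMap_mem_fil_one_iff hp _).2 (AinfRamTop.omegaPeriodHomO_mem_filOne W ψ _)
  · rw [hφ₂, hιB]
    haveI : IsDomain (BDeRhamPlus (integerC F) p) := isDomain_bDeRhamPlus hF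
    letI : Algebra F (FracBdR F p) := fracAlgebra hp hF
    exact algebraMap_mem_fil_zero hp hF _
  · obtain ⟨τ, hτ⟩ := hN1
    refine ⟨e.symm τ, fun h0 => hτ ?_⟩
    rw [hφ₁, LinearEquiv.apply_symm_apply, hιB] at h0
    have h1 := algebraMap_fracBdR_injective (F := F) (p := p) (h0.trans (map_zero _).symm)
    exact (BdRPlusTop.of F p).symm.injective (h1.trans (map_zero _).symm)
  · obtain ⟨τ, hτ⟩ := hNη
    refine ⟨e.symm τ, fun h => hτ ((algebraMap_mem_fil_one_iff hp _).1 ?_)⟩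
    rwa [hφ₂, LinearEquiv.apply_symm_apply, hιB] at h
  · rw [hιB]
    exact (algebraMap_mem_fil_one_iff hp _).2 (AinfRamTop.bOmega_mem_filOne W hup hQ)
  · rw [hιB]
    haveI : IsDomain (BDeRhamPlus (integerC F) p) := isDomain_bDeRhamPlus hF
    letI : Algebra F (FracBdR F p) := fracAlgebra hp hF
    exact algebraMap_mem_fil_zero hp hF _
  · rw [hφ₁, LinearEquiv.apply_symm_apply, ← hω σ, map_sub, hgal]
  · rw [hφ₂, LinearEquiv.apply_symm_apply, ← hη σ, map_sub, hgal]

/-- **The same for `𝒪_D`-RATIONAL base points** (parameter `c ∈ 𝔪_D`; the fixed lift is `AinfRamTop.coeffPt c`), with (HT)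
discharged: the Kummer cocycle of a `[p]_W`-division sequence of the `𝒪_D`-rational point with parameter `c` dies in
`H¹(F, B_dR⁺ ⊗ V_pW₀|_{Γ_F})`. [cite: BlochKato1990, Ex. 3.10.1, (3.11.1)] [cite: Kato1993LNM1553, Ch. II Lemma 1.4.3] -/
theorem isFilZeroCoboundary_kummerCocycleO_restricted_of_matching_of_coeffDisc_of_ne_zero (D : EisensteinRoot F p hp)
    (W : WeierstrassCurve (EisensteinRoot.CoeffDisc D)) (ψ : EisensteinRoot.CoeffDisc D →+* LTCoeff F)
    (hψ : ∀ c, algebraMap (LTCoeff F) F (ψ c) = EisensteinRoot.CoeffDisc.toF D c)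
    {K₀ : Type} [Field K₀] [CharZero K₀] (W₀ : WeierstrassCurve K₀) [W₀.IsElliptic] [Algebra K₀ F]
    (e : W₀.tateModule p ≃ₗ[ℤ_[p]] AinfTop.TatePtO F (W.map ψ) p)
    (he : ∀ (σ : absoluteGaloisGroup F) (a : W₀.tateModule p), e (absGaloisRestrict K₀ F σ • a) = σ • e a)
    (hN1 : ∃ τ : AinfTop.TatePtO F (W.map ψ) p, AinfRamTop.omegaPeriodHomO W ψ (surjective_fontaineTheta_integerC hp) hψ τ ≠ 0)
    (hNη : ∃ τ : AinfTop.TatePtO F (W.map ψ) p,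
      AinfRamTop.etaPeriodHomO W ψ (surjective_fontaineTheta_integerC hp) hψ τ ∉ (BdRPlusTop.filOne F p).toIdeal)
    {u : ℕ → (maxNilIdealC F).toIdeal} (hup : ∀ n, AinfRamTop.mulPC W (u (n + 1)) = u n) (c : EisensteinRoot.CoeffDisc D)
    (hc : ‖algebraMap F (CompletedAlgClosure F) (EisensteinRoot.CoeffDisc.toF D c)‖ < 1)
    (hu0 : (u 0 : CBall F) = algebraMap (EisensteinRoot.CoeffDisc D) (CBall F) c) :
    ∃ hu₀ : ∀ σ : absoluteGaloisGroup F, galCBall σ (u 0 : CBall F) = u 0,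
      (bdRPeriodRingData (F := F) (p := p) hp).IsFilZeroCoboundary (restrictedRationalTateRep W₀ F p) fun σ =>
        ((1 : (bdRPeriodRingData (F := F) (p := p) hp).B) ⊗ₜ[ℚ_[p]]
          TateModule.toRational p (e.symm (AinfRamTop.kummerCocycleO W ψ hψ u hup hu₀ σ)) :
          (bdRPeriodRingData (F := F) (p := p) hp).B ⊗[ℚ_[p]] W₀.rationalTateModule p) := by
  have hQ : AinfRamTop.thetaPt W (surjective_fontaineTheta_integerC hp) (AinfRamTop.coeffPt W (surjective_fontaineTheta_integerC hp) c hc)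
      = ⟨u 0⟩ :=
    WeierstrassCurve.Pt.ext (Subtype.ext (by rw [AinfRamTop.coe_val_thetaPt_coeffPt, hu0]))
  exact ⟨AinfRamTop.galCBall_base_eq_of_fixedLift W hQ fun σ => AinfRamTop.galPtN_coeffPt W σ c hc,
    isFilZeroCoboundary_kummerCocycleO_restricted_of_matching_of_ne_zero hp D W ψ hψ W₀ e he hN1 hNη hup hQ
      fun σ => AinfRamTop.galPtN_coeffPt W σ c hc⟩

/-! ## §4 The explicit supersingular cell models: no period hypothesis left -/

/-- **K1 for the explicit good supersingular `𝒪_D`-models, unconditionally in the periods.** Let `D = (X^e − p, ϖ)` be an Eisenstein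
datum of the `p`-adic field `F` (`p ∈ {5, 7}`), `W = W_D = ⟨0, 0, 0, a ϱ^{r₄}, b ϱ^{r₆}⟩` read over `CoeffDisc D` with `3r₄ = e t₄`,
`2r₆ = e t₆`, `64a³p^{t₄} + 432b²p^{t₆} ∈ ℤ_pˣ` and the (N1′) inequalities (`0 < r₄`, `e < 9`, `e < r₄ + 4` at `5`; `0 < r₆`, `e < 13`,
`e < r₆ + 6` at `7` — the K★ cells `(5; IV*) = (5; 3, 1)`, `(5; II*) = (5; 6, 4)`, `(7; III*) = (7; 4, ·, 2)` and `(5; IV) = (5; 3, 2)`),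
`ψ : 𝒪_D → 𝒪_F` the coefficient map, `W₀` elliptic over `K₀ ⊆ F` with an equivariant matching `e : T_pW₀ ≃ T_pŴ♭(𝒪_{ℂ_F})`. Then for
every `[p]_W`-division sequence `u` with a `Γ_F`-fixed lift `Q ∈ Ŵ(𝔫_𝒪)` of `u₀`, the Kummer cocycle `σ ↦ 1 ⊗ e⁻¹(κ_u σ)` is a
`Fil⁰`-coboundary of `B_dR(F) ⊗ V_pW₀|_{Γ_F}` — (N1′) by `omegaPeriod_model_{five,seven}_ne_zero_of_lt`, (Nη) by
`exists_etaPeriodHomO_not_mem_filOne` at the witness `‖p‖ < ‖τ₁‖^p`, (HT) by the Weil determinant (§2).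
[cite: BlochKato1990, Ex. 3.10.1, (3.11.1), Lemma 3.8.1] [cite: Tate1967, §4 Cor. 2] [cite: SilvermanAEC2009, IV.7.5 and VII.2.2] -/
theorem isFilZeroCoboundary_kummerCocycleO_restricted_of_matching_explicitModel (D : EisensteinRoot F p hp) {e : ℕ}
    (hD : D.poly = X ^ e - C (p : ℤ_[p])) (a b : ℤ_[p]) (r₄ r₆ t₄ t₆ : ℕ) (hp57 : p = 5 ∨ p = 7)
    (h5 : p = 5 → 0 < r₄ ∧ e < 9 ∧ e < r₄ + 4) (h7 : p = 7 → 0 < r₆ ∧ e < 13 ∧ e < r₆ + 6)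
    (h₄ : 3 * r₄ = e * t₄) (h₆ : 2 * r₆ = e * t₆) (hu : IsUnit (64 * a ^ 3 * (p : ℤ_[p]) ^ t₄ + 432 * b ^ 2 * (p : ℤ_[p]) ^ t₆))
    (ψ : EisensteinRoot.CoeffDisc D →+* LTCoeff F) (hψ : ∀ c, algebraMap (LTCoeff F) F (ψ c) = EisensteinRoot.CoeffDisc.toF D c)
    {K₀ : Type} [Field K₀] [CharZero K₀] (W₀ : WeierstrassCurve K₀) [W₀.IsElliptic] [Algebra K₀ F]
    (e : W₀.tateModule p ≃ₗ[ℤ_[p]] AinfTop.TatePtO F ((((⟨0, 0, 0, AdjoinRoot.of D.poly a * AdjoinRoot.root D.poly ^ r₄,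
      AdjoinRoot.of D.poly b * AdjoinRoot.root D.poly ^ r₆⟩ : WeierstrassCurve D.Coeff).map
      (EisensteinRoot.CoeffDisc.of D).toRingHom)).map ψ) p)
    (he : ∀ (σ : absoluteGaloisGroup F) (x : W₀.tateModule p), e (absGaloisRestrict K₀ F σ • x) = σ • e x)
    {u : ℕ → (maxNilIdealC F).toIdeal}
    (hup : ∀ n, AinfRamTop.mulPC (((⟨0, 0, 0, AdjoinRoot.of D.poly a * AdjoinRoot.root D.poly ^ r₄,
      AdjoinRoot.of D.poly b * AdjoinRoot.root D.poly ^ r₆⟩ : WeierstrassCurve D.Coeff).map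
      (EisensteinRoot.CoeffDisc.of D).toRingHom)) (u (n + 1)) = u n)
    {Q : (((⟨0, 0, 0, AdjoinRoot.of D.poly a * AdjoinRoot.root D.poly ^ r₄,
      AdjoinRoot.of D.poly b * AdjoinRoot.root D.poly ^ r₆⟩ : WeierstrassCurve D.Coeff).map
      (EisensteinRoot.CoeffDisc.of D).toRingHom)).Pt (AinfRamTop.nilTheta D (surjective_fontaineTheta_integerC hp))}
    (hQ : AinfRamTop.thetaPt _ (surjective_fontaineTheta_integerC hp) Q = ⟨u 0⟩)
    (hQσ : ∀ σ : absoluteGaloisGroup F, AinfRamTop.galPtN _ (surjective_fontaineTheta_integerC hp) σ Q = Q) :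
    (bdRPeriodRingData (F := F) (p := p) hp).IsFilZeroCoboundary (restrictedRationalTateRep W₀ F p) fun σ =>
      ((1 : (bdRPeriodRingData (F := F) (p := p) hp).B) ⊗ₜ[ℚ_[p]]
        TateModule.toRational p (e.symm (AinfRamTop.kummerCocycleO _ ψ hψ u hup
          (AinfRamTop.galCBall_base_eq_of_fixedLift _ hQ hQσ) σ)) :
        (bdRPeriodRingData (F := F) (p := p) hp).B ⊗[ℚ_[p]] W₀.rationalTateModule p) := by
  have hθ : Function.Surjective (WittVector.fontaineTheta (integerC F) p) := surjective_fontaineTheta_integerC hp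
  have hp2 : p ≠ 2 := by rcases hp57 with rfl | rfl <;> norm_num
  have hr₄ : p = 5 → 0 < r₄ := fun h => (h5 h).1
  have hr₆ : p = 7 → 0 < r₆ := fun h => (h7 h).1
  -- the residue characteristic
  haveI : CharP 𝓀[F] p := by
    refine (CharP.charP_iff_prime_eq_zero Fact.out).2 ?_
    rw [← map_natCast (IsLocalRing.residue 𝒪[F]), IsLocalRing.residue_eq_zero_iff, IsLocalRing.mem_maximalIdeal,
      mem_nonunits_iff, (Valuation.integer.integers (valuation F)).isUnit_iff_valuation_eq_one]
    rw [map_natCast]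
    exact hp.ne
  -- the reduction data of `W♭ = W_D ⊗_β 𝒪_F = W ⊗_ψ 𝒪_F`, `β = ψ ∘ of`, and the Tate-module witness
  have hΔ := AinfTop.isUnit_Δ_map_model (F := F) hD (ψ.comp (EisensteinRoot.CoeffDisc.of D).toRingHom) a b h₄ h₆ hu
  have hA := AinfTop.hasseCoeff_red_map_model_eq_zero hD (ψ.comp (EisensteinRoot.CoeffDisc.of D).toRingHom) a b hp57 hr₄ hr₆
  obtain ⟨τ, hτ1, hτp⟩ :=
    AinfTop.exists_tatePtO_norm_p_lt_norm_pow_model hD (ψ.comp (EisensteinRoot.CoeffDisc.of D).toRingHom) a b hp57 h₄ h₆ hu hr₄ hr₆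
  -- (N1′): `∫_t ω ≠ 0` whenever `t₁ ≠ 0`, in inequality form
  have hN1seq : ∀ {t : ℕ → (maxNilIdealC F).toIdeal} (ht0 : (t 0 : CBall F) = 0)
      (htp : ∀ n, AinfRamTop.mulPC (((⟨0, 0, 0, AdjoinRoot.of D.poly a * AdjoinRoot.root D.poly ^ r₄,
        AdjoinRoot.of D.poly b * AdjoinRoot.root D.poly ^ r₆⟩ : WeierstrassCurve D.Coeff).map
        (EisensteinRoot.CoeffDisc.of D).toRingHom)) (t (n + 1)) = t n),
      (t 1 : CBall F) ≠ 0 → AinfRamTop.omegaPeriod _ hθ t ht0 htp ≠ 0 := by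
    intro t ht0 htp h1
    rcases hp57 with rfl | rfl
    · obtain ⟨hr, he9, her⟩ := h5 rfl
      exact AinfRamTop.omegaPeriod_model_five_ne_zero_of_lt hD a b hr he9 her h₄ h₆ hu ht0 htp h1
    · obtain ⟨hr, he13, her⟩ := h7 rfl
      exact AinfRamTop.omegaPeriod_model_seven_ne_zero_of_lt hD a b hr he13 her h₄ h₆ hu ht0 htp h1
  have hN1 := AinfRamTop.exists_omegaPeriodHomO_ne_zero _ ψ (hθ := hθ) (hψ := hψ) hN1seq ⟨τ, hτ1⟩
  -- (Nη′): `∫_τ η ∉ Fil¹`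
  have hNη := AinfRamTop.exists_etaPeriodHomO_not_mem_filOne (hθ := hθ)
    (((⟨0, 0, 0, AdjoinRoot.of D.poly a * AdjoinRoot.root D.poly ^ r₄, AdjoinRoot.of D.poly b * AdjoinRoot.root D.poly ^ r₆⟩ :
      WeierstrassCurve D.Coeff).map (EisensteinRoot.CoeffDisc.of D).toRingHom)) ψ hψ hp2 hΔ hA ⟨τ, hτp⟩
  exact isFilZeroCoboundary_kummerCocycleO_restricted_of_matching_of_ne_zero hp D _ ψ hψ W₀ e he hN1 hNη hup hQ hQσ

/-- **(HT) for the explicit cell models, as a stand-alone witness**: under the cell hypotheses of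
`isFilZeroCoboundary_kummerCocycleO_restricted_of_matching_explicitModel` and given an equivariant matching `e`, some Tate-module point
`τ ∈ T_pŴ♭(𝒪_{ℂ_F})` has `∫_τ ω ∉ (Fil¹ B_dR⁺)²` — Tate's Hodge–Tate nonvanishing for the potentially supersingular cells of K★ and TDS57.
[cite: Tate1967, §4 Cor. 2] [cite: Fontaine1982FormesDifferentielles, §5] [cite: SilvermanAEC2009, IV.7.5 and VII.2.2] -/
theorem AinfRamTop.exists_omegaPeriodHomO_not_mem_filOne_sq_explicitModel (D : EisensteinRoot F p hp) {e : ℕ}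
    (hD : D.poly = X ^ e - C (p : ℤ_[p])) (a b : ℤ_[p]) (r₄ r₆ t₄ t₆ : ℕ) (hp57 : p = 5 ∨ p = 7)
    (h5 : p = 5 → 0 < r₄ ∧ e < 9 ∧ e < r₄ + 4) (h7 : p = 7 → 0 < r₆ ∧ e < 13 ∧ e < r₆ + 6)
    (h₄ : 3 * r₄ = e * t₄) (h₆ : 2 * r₆ = e * t₆) (hu : IsUnit (64 * a ^ 3 * (p : ℤ_[p]) ^ t₄ + 432 * b ^ 2 * (p : ℤ_[p]) ^ t₆))
    (ψ : EisensteinRoot.CoeffDisc D →+* LTCoeff F) (hψ : ∀ c, algebraMap (LTCoeff F) F (ψ c) = EisensteinRoot.CoeffDisc.toF D c)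
    {K₀ : Type} [Field K₀] [CharZero K₀] (W₀ : WeierstrassCurve K₀) [W₀.IsElliptic] [Algebra K₀ F]
    (e : W₀.tateModule p ≃ₗ[ℤ_[p]] AinfTop.TatePtO F ((((⟨0, 0, 0, AdjoinRoot.of D.poly a * AdjoinRoot.root D.poly ^ r₄,
      AdjoinRoot.of D.poly b * AdjoinRoot.root D.poly ^ r₆⟩ : WeierstrassCurve D.Coeff).map
      (EisensteinRoot.CoeffDisc.of D).toRingHom)).map ψ) p)
    (he : ∀ (σ : absoluteGaloisGroup F) (x : W₀.tateModule p), e (absGaloisRestrict K₀ F σ • x) = σ • e x) :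
    ∃ τ, AinfRamTop.omegaPeriodHomO (((⟨0, 0, 0, AdjoinRoot.of D.poly a * AdjoinRoot.root D.poly ^ r₄,
        AdjoinRoot.of D.poly b * AdjoinRoot.root D.poly ^ r₆⟩ : WeierstrassCurve D.Coeff).map
        (EisensteinRoot.CoeffDisc.of D).toRingHom)) ψ (surjective_fontaineTheta_integerC hp) hψ τ ∉
      ((BdRPlusTop.filOne F p).toIdeal ^ 2 : Ideal (BdRPlusTop F p)) := by
  have hθ : Function.Surjective (WittVector.fontaineTheta (integerC F) p) := surjective_fontaineTheta_integerC hp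
  have hp2 : p ≠ 2 := by rcases hp57 with rfl | rfl <;> norm_num
  have hr₄ : p = 5 → 0 < r₄ := fun h => (h5 h).1
  have hr₆ : p = 7 → 0 < r₆ := fun h => (h7 h).1
  haveI : CharP 𝓀[F] p := by
    refine (CharP.charP_iff_prime_eq_zero Fact.out).2 ?_
    rw [← map_natCast (IsLocalRing.residue 𝒪[F]), IsLocalRing.residue_eq_zero_iff, IsLocalRing.mem_maximalIdeal,
      mem_nonunits_iff, (Valuation.integer.integers (valuation F)).isUnit_iff_valuation_eq_one]
    rw [map_natCast]
    exact hp.ne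
  have hΔ := AinfTop.isUnit_Δ_map_model (F := F) hD (ψ.comp (EisensteinRoot.CoeffDisc.of D).toRingHom) a b h₄ h₆ hu
  have hA := AinfTop.hasseCoeff_red_map_model_eq_zero hD (ψ.comp (EisensteinRoot.CoeffDisc.of D).toRingHom) a b hp57 hr₄ hr₆
  obtain ⟨τ, hτ1, hτp⟩ :=
    AinfTop.exists_tatePtO_norm_p_lt_norm_pow_model hD (ψ.comp (EisensteinRoot.CoeffDisc.of D).toRingHom) a b hp57 h₄ h₆ hu hr₄ hr₆
  have hN1seq : ∀ {t : ℕ → (maxNilIdealC F).toIdeal} (ht0 : (t 0 : CBall F) = 0)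
      (htp : ∀ n, AinfRamTop.mulPC (((⟨0, 0, 0, AdjoinRoot.of D.poly a * AdjoinRoot.root D.poly ^ r₄,
        AdjoinRoot.of D.poly b * AdjoinRoot.root D.poly ^ r₆⟩ : WeierstrassCurve D.Coeff).map
        (EisensteinRoot.CoeffDisc.of D).toRingHom)) (t (n + 1)) = t n),
      (t 1 : CBall F) ≠ 0 → AinfRamTop.omegaPeriod _ hθ t ht0 htp ≠ 0 := by
    intro t ht0 htp h1
    rcases hp57 with rfl | rfl
    · obtain ⟨hr, he9, her⟩ := h5 rfl
      exact AinfRamTop.omegaPeriod_model_five_ne_zero_of_lt hD a b hr he9 her h₄ h₆ hu ht0 htp h1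
    · obtain ⟨hr, he13, her⟩ := h7 rfl
      exact AinfRamTop.omegaPeriod_model_seven_ne_zero_of_lt hD a b hr he13 her h₄ h₆ hu ht0 htp h1
  have hN1 := AinfRamTop.exists_omegaPeriodHomO_ne_zero _ ψ (hθ := hθ) (hψ := hψ) hN1seq ⟨τ, hτ1⟩
  have hNη := AinfRamTop.exists_etaPeriodHomO_not_mem_filOne (hθ := hθ)
    (((⟨0, 0, 0, AdjoinRoot.of D.poly a * AdjoinRoot.root D.poly ^ r₄, AdjoinRoot.of D.poly b * AdjoinRoot.root D.poly ^ r₆⟩ :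
      WeierstrassCurve D.Coeff).map (EisensteinRoot.CoeffDisc.of D).toRingHom)) ψ hψ hp2 hΔ hA ⟨τ, hτp⟩
  exact AinfRamTop.exists_omegaPeriodHomO_not_mem_filOne_sq_of_matching hp D _ ψ hψ W₀ e he hN1 hNη

end Literature.NumberTheory.PAdicHodge

end
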